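import Literature.Analysis.SpecialFunctions.PeriodicArgComp
import Mathlib.Analysis.SpecialFunctions.SmoothTransition
import Mathlib.Analysis.InnerProductSpace.Calculus
import Mathlib.Analysis.Complex.RealDeriv
import HarnessLib

/-!
# Globally smooth truncations of the argument on `ℂ`

Topic `Literature/Analysis/SpecialFunctions`. The argument `arg : ℂ → (-π, π]` is smooth on the
slit plane only. For scaling arguments one needs GLOBALLY smooth substitutes which agree with
`arg` on a closed sector `{‖u‖ ≥ r, |arg u| ≤ a}` (`a < π`) and vanish near the negative real axis
and near the origin. PROVED here, without ever composing with `arg` where it is not smooth: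

* `cosCutoff c₁ c₂ u = S((Re u/‖u‖ - c₂)/(c₁ - c₂))` (`S = Real.smoothTransition`, `c₂ < c₁`): a
  sectorial cutoff written through `cos(arg u) = Re u/‖u‖`, `= 1` where `Re u/‖u‖ ≥ c₁` and `= 0`
  where `Re u/‖u‖ ≤ c₂`, smooth on `ℂ ∖ {0}`;
* `radialCutoffC r u = S((‖u‖² - r²/4)/(¾r²))`: `= 0` on `‖u‖ ≤ r/2`, `= 1` on `‖u‖ ≥ r`, smooth;
* `truncOne r c₁ c₂ = radialCutoffC · cosCutoff` — smooth on ALL of `ℂ` (`contDiff_truncOne`);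
* `truncArg r c₁ c₂ = truncOne · arg` — smooth on ALL of `ℂ` for `-1 < c₂` (`contDiff_truncArg`:
  near the negative real axis `Re u/‖u‖` is close to `-1 < c₂`, so the cutoff vanishes
  identically there; near `0` the radial cutoff does), and `truncArg = arg` on
  `{‖u‖ ≥ r, Re u/‖u‖ ≥ c₁}` (`truncArg_eq_arg`);
* `cos_le_re_div_norm_of_abs_arg_le`, `re_div_norm_le_cos_of_le_abs_arg` — the dictionary
  `|arg u| ≤ a ⟹ cos a ≤ Re u/‖u‖` and `b ≤ |arg u| ⟹ Re u/‖u‖ ≤ cos b` (`0 ≤ a, b ≤ π`).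

USE: the `h`-uniform symbol estimates of anisotropic sectors (Benfatto–Giuliani–Mastropietro
2006, Lemma 2.2), where the relative polar angle of the momentum is rescaled by `γ^{-h/2}`.
Everything is PROVED; the definitions are the four functions. [folklore]
-/

noncomputable section

open Real Set Complex Filter
open scoped Topology ContDiff

namespace Literature.Analysis.SpecialFunctions

/-! ### The dictionary between `|arg u|` and `Re u / ‖u‖` -/

/-- `|arg u| ≤ a ≤ π` implies `cos a ≤ Re u/‖u‖` (`u ≠ 0`). [folklore] -/
theorem cos_le_re_div_norm_of_abs_arg_le {u : ℂ} (hu : u ≠ 0) {a : ℝ} (ha : a ≤ π) (h : |arg u| ≤ a) :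
    Real.cos a ≤ u.re / ‖u‖ := by
  rw [← Complex.cos_arg hu, ← Real.cos_abs (arg u)]
  exact Real.cos_le_cos_of_nonneg_of_le_pi (abs_nonneg _) ha h

/-- `b ≤ |arg u|`, `0 ≤ b` implies `Re u/‖u‖ ≤ cos b` (`u ≠ 0`). [folklore] -/
theorem re_div_norm_le_cos_of_le_abs_arg {u : ℂ} (hu : u ≠ 0) {b : ℝ} (hb : 0 ≤ b) (h : b ≤ |arg u|) :
    u.re / ‖u‖ ≤ Real.cos b := by
  rw [← Complex.cos_arg hu, ← Real.cos_abs (arg u)]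
  exact Real.cos_le_cos_of_nonneg_of_le_pi hb (abs_arg_le_pi u) h

/-- `-1 ≤ Re u/‖u‖`. [folklore] -/
theorem neg_one_le_re_div_norm (u : ℂ) : -1 ≤ u.re / ‖u‖ := by
  rcases eq_or_ne u 0 with rfl | hu
  · simp
  · rw [le_div_iff₀ (norm_pos_iff.2 hu)]
    have := Complex.abs_re_le_norm u
    have := neg_abs_le u.re
    linarith

/-! ### The sectorial cutoff -/

/-- The sectorial cutoff `S((Re u/‖u‖ - c₂)/(c₁ - c₂))`. [folklore] -/
def cosCutoff (c₁ c₂ : ℝ) (u : ℂ) : ℝ := Real.smoothTransition ((u.re / ‖u‖ - c₂) / (c₁ - c₂))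

/-- `0 ≤ cosCutoff ≤ 1`. [folklore] -/
theorem cosCutoff_mem_Icc (c₁ c₂ : ℝ) (u : ℂ) : cosCutoff c₁ c₂ u ∈ Icc (0 : ℝ) 1 :=
  ⟨Real.smoothTransition.nonneg _, Real.smoothTransition.le_one _⟩

/-- `cosCutoff = 1` where `Re u/‖u‖ ≥ c₁`. [folklore] -/
theorem cosCutoff_eq_one {c₁ c₂ : ℝ} (hc : c₂ < c₁) {u : ℂ} (h : c₁ ≤ u.re / ‖u‖) : cosCutoff c₁ c₂ u = 1 := by
  refine Real.smoothTransition.one_of_one_le ?_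
  rw [le_div_iff₀ (by linarith), one_mul]
  linarith

/-- `cosCutoff = 0` where `Re u/‖u‖ ≤ c₂`. [folklore] -/
theorem cosCutoff_eq_zero {c₁ c₂ : ℝ} (hc : c₂ < c₁) {u : ℂ} (h : u.re / ‖u‖ ≤ c₂) : cosCutoff c₁ c₂ u = 0 :=
  Real.smoothTransition.zero_of_nonpos (div_nonpos_of_nonpos_of_nonneg (by linarith) (by linarith))

/-- `u ↦ Re u / ‖u‖` is smooth away from `0`. [folklore] -/
theorem contDiffAt_re_div_norm {u : ℂ} (hu : u ≠ 0) {n : WithTop ℕ∞} : ContDiffAt ℝ n (fun u : ℂ => u.re / ‖u‖) u :=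
  Complex.reCLM.contDiff.contDiffAt.div (contDiffAt_norm ℝ hu) (norm_ne_zero_iff.2 hu)

/-- The sectorial cutoff is smooth away from `0`. [folklore] -/
theorem contDiffAt_cosCutoff (c₁ c₂ : ℝ) {u : ℂ} (hu : u ≠ 0) {n : ℕ∞} :
    ContDiffAt ℝ n (cosCutoff c₁ c₂) u :=
  Real.smoothTransition.contDiff.contDiffAt.comp u (((contDiffAt_re_div_norm hu).sub contDiffAt_const).div_const _)

/-- **Near a point with `Re u/‖u‖ < c₂` the sectorial cutoff vanishes identically.** [folklore] -/
theorem cosCutoff_eventuallyEq_zero {c₁ c₂ : ℝ} (hc : c₂ < c₁) {u : ℂ} (hu : u ≠ 0) (h : u.re / ‖u‖ < c₂) :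
    cosCutoff c₁ c₂ =ᶠ[𝓝 u] fun _ => 0 := by
  have hcont : ContinuousAt (fun u : ℂ => u.re / ‖u‖) u := (contDiffAt_re_div_norm hu (n := 0)).continuousAt
  have hev : ∀ᶠ v in 𝓝 u, v.re / ‖v‖ < c₂ := hcont.eventually (gt_mem_nhds h)
  filter_upwards [hev] with v hv
  exact cosCutoff_eq_zero hc hv.le

/-! ### The radial cutoff -/

/-- The radial cutoff `S((‖u‖² - r²/4)/(¾r²))`. [folklore] -/
def radialCutoffC (r : ℝ) (u : ℂ) : ℝ := Real.smoothTransition ((‖u‖ ^ 2 - (r / 2) ^ 2) / (r ^ 2 - (r / 2) ^ 2))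

/-- `0 ≤ radialCutoffC ≤ 1`. [folklore] -/
theorem radialCutoffC_mem_Icc (r : ℝ) (u : ℂ) : radialCutoffC r u ∈ Icc (0 : ℝ) 1 :=
  ⟨Real.smoothTransition.nonneg _, Real.smoothTransition.le_one _⟩

/-- `radialCutoffC = 0` on `‖u‖ ≤ r/2` (`0 < r`). [folklore] -/
theorem radialCutoffC_eq_zero {r : ℝ} (hr : 0 < r) {u : ℂ} (h : ‖u‖ ≤ r / 2) : radialCutoffC r u = 0 := by
  refine Real.smoothTransition.zero_of_nonpos (div_nonpos_of_nonpos_of_nonneg ?_ ?_)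
  · nlinarith [norm_nonneg u]
  · nlinarith

/-- `radialCutoffC = 1` on `‖u‖ ≥ r` (`0 < r`). [folklore] -/
theorem radialCutoffC_eq_one {r : ℝ} (hr : 0 < r) {u : ℂ} (h : r ≤ ‖u‖) : radialCutoffC r u = 1 := by
  refine Real.smoothTransition.one_of_one_le ?_
  rw [le_div_iff₀ (by nlinarith), one_mul]
  nlinarith

/-- The radial cutoff is smooth. [folklore] -/
theorem contDiff_radialCutoffC (r : ℝ) {n : ℕ∞} : ContDiff ℝ n (radialCutoffC r) :=
  Real.smoothTransition.contDiff.comp (((contDiff_norm_sq ℝ).sub contDiff_const).div_const _)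

/-- Near `0` the radial cutoff vanishes identically (`0 < r`). [folklore] -/
theorem radialCutoffC_eventuallyEq_zero {r : ℝ} (hr : 0 < r) : radialCutoffC r =ᶠ[𝓝 (0 : ℂ)] fun _ => 0 := by
  have hev : ∀ᶠ v in 𝓝 (0 : ℂ), ‖v‖ < r / 2 := by
    have : Metric.ball (0 : ℂ) (r / 2) ∈ 𝓝 (0 : ℂ) := Metric.ball_mem_nhds 0 (by linarith)
    filter_upwards [this] with v hv
    simpa using hv
  filter_upwards [hev] with v hv
  exact radialCutoffC_eq_zero hr hv.le

/-! ### The truncations -/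

/-- The sector truncation `ψ = radialCutoffC · cosCutoff`. [folklore] -/
def truncOne (r c₁ c₂ : ℝ) (u : ℂ) : ℝ := radialCutoffC r u * cosCutoff c₁ c₂ u

/-- The truncated argument `ψ · arg`. [folklore] -/
def truncArg (r c₁ c₂ : ℝ) (u : ℂ) : ℝ := truncOne r c₁ c₂ u * arg u

/-- `0 ≤ ψ ≤ 1`. [folklore] -/
theorem truncOne_mem_Icc (r c₁ c₂ : ℝ) (u : ℂ) : truncOne r c₁ c₂ u ∈ Icc (0 : ℝ) 1 :=
  ⟨mul_nonneg (radialCutoffC_mem_Icc r u).1 (cosCutoff_mem_Icc c₁ c₂ u).1,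
    mul_le_one₀ (radialCutoffC_mem_Icc r u).2 (cosCutoff_mem_Icc c₁ c₂ u).1 (cosCutoff_mem_Icc c₁ c₂ u).2⟩

/-- **`ψ` is smooth on all of `ℂ`.** [folklore] -/
theorem contDiff_truncOne {r c₁ c₂ : ℝ} (hr : 0 < r) {n : ℕ∞} : ContDiff ℝ n (truncOne r c₁ c₂) := by
  refine contDiff_iff_contDiffAt.2 fun u => ?_
  rcases eq_or_ne u 0 with rfl | hu
  · -- near `0` the radial factor vanishes identically
    have hev : truncOne r c₁ c₂ =ᶠ[𝓝 (0 : ℂ)] fun _ => 0 := by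
      filter_upwards [radialCutoffC_eventuallyEq_zero hr] with v hv
      rw [truncOne, hv, zero_mul]
    exact (contDiffAt_const (c := (0 : ℝ))).congr_of_eventuallyEq hev
  · exact (contDiff_radialCutoffC r).contDiffAt.mul (contDiffAt_cosCutoff c₁ c₂ hu)

/-- `ψ = 1` on the closed sector `{‖u‖ ≥ r, Re u/‖u‖ ≥ c₁}`. [folklore] -/
theorem truncOne_eq_one {r c₁ c₂ : ℝ} (hr : 0 < r) (hc : c₂ < c₁) {u : ℂ} (h1 : r ≤ ‖u‖) (h2 : c₁ ≤ u.re / ‖u‖) :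
    truncOne r c₁ c₂ u = 1 := by
  rw [truncOne, radialCutoffC_eq_one hr h1, cosCutoff_eq_one hc h2, one_mul]

/-- `ψ = 0` where `Re u/‖u‖ ≤ c₂`. [folklore] -/
theorem truncOne_eq_zero_of_re {r c₁ c₂ : ℝ} (hc : c₂ < c₁) {u : ℂ} (h : u.re / ‖u‖ ≤ c₂) :
    truncOne r c₁ c₂ u = 0 := by
  rw [truncOne, cosCutoff_eq_zero hc h, mul_zero]

/-- `ψ = 0` on `‖u‖ ≤ r/2`. [folklore] -/
theorem truncOne_eq_zero_of_norm {r c₁ c₂ : ℝ} (hr : 0 < r) {u : ℂ} (h : ‖u‖ ≤ r / 2) :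
    truncOne r c₁ c₂ u = 0 := by
  rw [truncOne, radialCutoffC_eq_zero hr h, zero_mul]

/-- **The truncated argument is smooth on all of `ℂ`** (`-1 < c₂ < c₁`, `0 < r`): at a point of
the negative real axis `Re u/‖u‖ = -1 < c₂`, so the sectorial cutoff vanishes near it; at the
origin the radial cutoff does; elsewhere `arg` is smooth (the slit plane). [folklore] -/
theorem contDiff_truncArg {r c₁ c₂ : ℝ} (hr : 0 < r) (hc : c₂ < c₁) (hc₂ : -1 < c₂) {n : ℕ∞} :
    ContDiff ℝ n (truncArg r c₁ c₂) := by
  refine contDiff_iff_contDiffAt.2 fun u => ?_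
  rcases eq_or_ne u 0 with rfl | hu
  · have hev : truncArg r c₁ c₂ =ᶠ[𝓝 (0 : ℂ)] fun _ => 0 := by
      filter_upwards [radialCutoffC_eventuallyEq_zero hr] with v hv
      rw [truncArg, truncOne, hv, zero_mul, zero_mul]
    exact (contDiffAt_const (c := (0 : ℝ))).congr_of_eventuallyEq hev
  · by_cases hs : u ∈ slitPlane
    · exact (contDiff_truncOne hr).contDiffAt.mul (contDiffAt_arg_of_mem_slitPlane hs)
    · -- on the negative real axis: `Re u/‖u‖ = -1 < c₂`
      rw [Complex.mem_slitPlane_iff, not_or, not_lt, not_ne_iff] at hs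
      have hre : u.re < 0 := lt_of_le_of_ne hs.1 fun h => hu (Complex.ext h hs.2)
      have hnorm : ‖u‖ = -u.re := by
        have h1 : ‖u‖ = |u.re| := by
          rw [← Complex.re_add_im u, hs.2]
          simp [Complex.norm_real]
        rw [h1, abs_of_neg hre]
      have hratio : u.re / ‖u‖ < c₂ := by
        rw [hnorm, div_neg, div_self hre.ne]
        exact hc₂
      have hev : truncArg r c₁ c₂ =ᶠ[𝓝 u] fun _ => 0 := by
        filter_upwards [cosCutoff_eventuallyEq_zero hc hu hratio] with v hv
        rw [truncArg, truncOne, hv, mul_zero, zero_mul]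
      exact (contDiffAt_const (c := (0 : ℝ))).congr_of_eventuallyEq hev

/-- **The truncated argument is the argument on the closed sector** `{‖u‖ ≥ r, Re u/‖u‖ ≥ c₁}`. [folklore] -/
theorem truncArg_eq_arg {r c₁ c₂ : ℝ} (hr : 0 < r) (hc : c₂ < c₁) {u : ℂ} (h1 : r ≤ ‖u‖) (h2 : c₁ ≤ u.re / ‖u‖) :
    truncArg r c₁ c₂ u = arg u := by
  rw [truncArg, truncOne_eq_one hr hc h1 h2, one_mul]

/-- In terms of angles: `truncArg = arg` on `{‖u‖ ≥ r, |arg u| ≤ a}` when `c₁ ≤ cos a`, `a ≤ π`. [folklore] -/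
theorem truncArg_eq_arg_of_abs_arg_le {r c₁ c₂ : ℝ} (hr : 0 < r) (hc : c₂ < c₁) {a : ℝ} (ha : a ≤ π)
    (hca : c₁ ≤ Real.cos a) {u : ℂ} (h1 : r ≤ ‖u‖) (h2 : |arg u| ≤ a) :
    truncArg r c₁ c₂ u = arg u := by
  have hu : u ≠ 0 := by rintro rfl; simp at h1; linarith
  exact truncArg_eq_arg hr hc h1 (hca.trans (cos_le_re_div_norm_of_abs_arg_le hu ha h2))

/-- `ψ = 1` on `{‖u‖ ≥ r, |arg u| ≤ a}` when `c₁ ≤ cos a`, `a ≤ π`. [folklore] -/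
theorem truncOne_eq_one_of_abs_arg_le {r c₁ c₂ : ℝ} (hr : 0 < r) (hc : c₂ < c₁) {a : ℝ} (ha : a ≤ π)
    (hca : c₁ ≤ Real.cos a) {u : ℂ} (h1 : r ≤ ‖u‖) (h2 : |arg u| ≤ a) :
    truncOne r c₁ c₂ u = 1 := by
  have hu : u ≠ 0 := by rintro rfl; simp at h1; linarith
  exact truncOne_eq_one hr hc h1 (hca.trans (cos_le_re_div_norm_of_abs_arg_le hu ha h2))

/-- `ψ = 0` on `{b ≤ |arg u|}` when `cos b ≤ c₂`, `0 ≤ b` (`u ≠ 0`). [folklore] -/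
theorem truncOne_eq_zero_of_le_abs_arg {r c₁ c₂ : ℝ} (hc : c₂ < c₁) {b : ℝ} (hb : 0 ≤ b) (hcb : Real.cos b ≤ c₂)
    {u : ℂ} (hu : u ≠ 0) (h : b ≤ |arg u|) : truncOne r c₁ c₂ u = 0 :=
  truncOne_eq_zero_of_re hc ((re_div_norm_le_cos_of_le_abs_arg hu hb h).trans hcb)

end Literature.Analysis.SpecialFunctions

end
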